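import Mathlib
import Summits.ValiantsHypothesis.ValiantsHypothesis.Theorems.LacunarySymmetroidMatrixDescartesDefiniteMomentsZonesRayleigh

/-!
# `MatrixDescartes` (stmt-ValiantsHypothesis-18050) — the DEFINITE-MOMENTS LAW, zones III: local structure of the
# Rayleigh roots (one root per window near a sharp vector)

HONEST FRAMING.  Cell `pub-symmetroid`, seat `val-sym-mdr-p2` (gen 15); helper file `--supports` the crux
`Theses.LacunarySymmetroid.MatrixDescartes`, NO closure claim.  Step (1) of the lacunary Markus theorem; nothing here
bears on the crux in its window, on `stub_twoSided`, on `DoorA26`/`DoorA34`, registers, or `VP ≠ VNP`.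

CONTENT.  Rayleigh-sharp pencil (`K ≥ 2` real letters at strictly increasing exponents, every Rayleigh `K`-nomial `P_u`,
`u ≠ 0`, with `K − 1` distinct positive roots).  `locRoots`: if `r₀ < ⋯ < r_{K−2}` enumerate the positive roots of `P_v`
and `δ > 0` makes the windows `(rᵢ − δ, rᵢ + δ)` disjoint inside `(0, ∞)`, then for every `v'` close enough to `v` the
positive roots of `P_{v'}` are enumerated by some `z` with `zᵢ ∈ (rᵢ − δ, rᵢ + δ)` — exactly one root per window, none
elsewhere (sign flips at the window ends survive a small perturbation; intermediate value theorem; Descartes' budget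
`K − 1`).  Counting consequences (`count_eq_of_far`, `count_at_root_lower/upper`, `count_at_common_root`) and the choice
of a small `δ` (`exists_window_radius`). [folklore]; axioms `propext`, `Classical.choice`, `Quot.sound`; no definitions.
-/

-- layout Summits/ValiantsHypothesis/ValiantsHypothesis forces the duplicated namespace component
set_option linter.dupNamespace false

namespace Summit.ValiantsHypothesis.ValiantsHypothesis.Theorems.LacunarySymmetroidMatrixDescartes

open Polynomial Matrix Finset
open scoped BigOperators

namespace DefiniteMoments

/-! ## §1 Windows: combinatorics of enumerations -/

section Windows

variable {n : ℕ}

/-- An enumeration with one point per window of a separated strictly increasing family is strictly increasing.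
[folklore] -/
theorem strictMono_of_windows (r z : Fin n → ℝ) (δ : ℝ) (hsep : ∀ i j : Fin n, i < j → r i + δ ≤ r j - δ)
    (hz : ∀ i, r i - δ < z i ∧ z i < r i + δ) : StrictMono z := by
  intro i j hij
  have h := hsep i j hij
  linarith [(hz i).2, (hz j).1]

/-- Window points are injective. [folklore] -/
theorem injective_of_windows (r z : Fin n → ℝ) (δ : ℝ) (hsep : ∀ i j : Fin n, i < j → r i + δ ≤ r j - δ)
    (hz : ∀ i, r i - δ < z i ∧ z i < r i + δ) : Function.Injective z :=
  (strictMono_of_windows r z δ hsep hz).injective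

/-- Two windows containing a common point coincide. [folklore] -/
theorem window_index_eq (r : Fin n → ℝ) (δ : ℝ) (hsep : ∀ i j : Fin n, i < j → r i + δ ≤ r j - δ)
    {i j : Fin n} {x : ℝ} (hi : r i - δ < x ∧ x < r i + δ) (hj : r j - δ < x ∧ x < r j + δ) : i = j := by
  by_contra hne
  rcases lt_or_gt_of_ne hne with h | h
  · have := hsep i j h; linarith [hi.2, hj.1]
  · have := hsep j i h; linarith [hj.2, hi.1]

/-- Counting through an enumeration: `#{x ∈ T : p x} = #{i : p (z i)}`. [folklore] -/
theorem card_filter_enum (T : Finset ℝ) (z : Fin n → ℝ) (hz : Function.Injective z)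
    (hT : ∀ x : ℝ, x ∈ T ↔ ∃ i, z i = x) (p : ℝ → Prop) [DecidablePred p] :
    (T.filter p).card = ((Finset.univ : Finset (Fin n)).filter (fun i => p (z i))).card := by
  have h : T.filter p = ((Finset.univ : Finset (Fin n)).filter (fun i => p (z i))).image z := by
    ext x
    simp only [Finset.mem_filter, Finset.mem_image, Finset.mem_univ, true_and, hT]
    constructor
    · rintro ⟨⟨i, rfl⟩, hp⟩; exact ⟨i, hp, rfl⟩
    · rintro ⟨i, hp, rfl⟩; exact ⟨⟨i, rfl⟩, hp⟩
  rw [h, Finset.card_image_of_injective _ hz]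

/-- For a strictly increasing enumeration, `#{i : r i < r i₀} = #{i : i < i₀}`. [folklore] -/
theorem filter_lt_enum (r : Fin n → ℝ) (hr : StrictMono r) (i₀ : Fin n) :
    (Finset.univ : Finset (Fin n)).filter (fun i => r i < r i₀) = Finset.univ.filter (fun i => i < i₀) := by
  ext i; simp only [Finset.mem_filter, Finset.mem_univ, true_and, hr.lt_iff_lt]

/-- **Far point**: a point at distance `≥ δ` from every `rᵢ` sees the same number of window points as of centres below
it, and is itself no window point. [folklore] -/
theorem count_eq_of_far (r z : Fin n → ℝ) (δ : ℝ) (hz : ∀ i, r i - δ < z i ∧ z i < r i + δ) (x : ℝ)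
    (hfar : ∀ i, r i + δ ≤ x ∨ x ≤ r i - δ) :
    ((Finset.univ : Finset (Fin n)).filter (fun i => z i < x)).card
        = ((Finset.univ : Finset (Fin n)).filter (fun i => r i < x)).card ∧ ∀ i, z i ≠ x := by
  constructor
  · congr 1
    ext i
    simp only [Finset.mem_filter, Finset.mem_univ, true_and]
    rcases hfar i with h | h
    · constructor
      · intro _; linarith [(hz i).1, (hz i).2]
      · intro _; linarith [(hz i).1, (hz i).2]
    · constructor
      · intro h'; linarith [(hz i).1, (hz i).2]
      · intro h'; linarith [(hz i).1, (hz i).2]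
  · intro i h
    rcases hfar i with h' | h'
    · linarith [(hz i).2]
    · linarith [(hz i).1]

/-- **At a centre, lower count**: every window strictly below the `i₀`-th has its point below `r i₀`. [folklore] -/
theorem count_at_root_lower (r z : Fin n → ℝ) (hr : StrictMono r) (δ : ℝ) (hδ : 0 < δ)
    (hsep : ∀ i j : Fin n, i < j → r i + δ ≤ r j - δ) (hz : ∀ i, r i - δ < z i ∧ z i < r i + δ) (i₀ : Fin n) :
    ((Finset.univ : Finset (Fin n)).filter (fun i => r i < r i₀)).card
      ≤ ((Finset.univ : Finset (Fin n)).filter (fun i => z i < r i₀)).card := by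
  refine Finset.card_le_card fun i hi => ?_
  simp only [Finset.mem_filter, Finset.mem_univ, true_and] at hi ⊢
  have h := hsep i i₀ (hr.lt_iff_lt.1 hi)
  linarith [(hz i).2]

/-- **At a centre, upper count**: only the windows up to the `i₀`-th can have their point at or below `r i₀`. [folklore] -/
theorem count_at_root_upper (r z : Fin n → ℝ) (hr : StrictMono r) (δ : ℝ) (hδ : 0 < δ)
    (hsep : ∀ i j : Fin n, i < j → r i + δ ≤ r j - δ) (hz : ∀ i, r i - δ < z i ∧ z i < r i + δ) (i₀ : Fin n) :
    ((Finset.univ : Finset (Fin n)).filter (fun i => z i ≤ r i₀)).card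
      ≤ ((Finset.univ : Finset (Fin n)).filter (fun i => r i < r i₀)).card + 1 := by
  have hsub : (Finset.univ : Finset (Fin n)).filter (fun i => z i ≤ r i₀)
      ⊆ insert i₀ ((Finset.univ : Finset (Fin n)).filter (fun i => r i < r i₀)) := by
    intro i hi
    simp only [Finset.mem_filter, Finset.mem_univ, true_and, Finset.mem_insert] at hi ⊢
    by_cases h : i = i₀
    · exact Or.inl h
    · right
      rcases lt_or_gt_of_ne h with hlt | hgt
      · exact hr hlt
      · have h' := hsep i₀ i hgt
        linarith [(hz i).1]
  exact (Finset.card_le_card hsub).trans (Finset.card_insert_le _ _)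

/-- **At a common root**: if the centre `r i₀` is itself a window point then it is the `i₀`-th one and the counts below
it agree. [folklore] -/
theorem count_at_common_root (r z : Fin n → ℝ) (hr : StrictMono r) (δ : ℝ) (hδ : 0 < δ)
    (hsep : ∀ i j : Fin n, i < j → r i + δ ≤ r j - δ) (hz : ∀ i, r i - δ < z i ∧ z i < r i + δ) (i₀ : Fin n)
    (hmem : ∃ i₁, z i₁ = r i₀) :
    ((Finset.univ : Finset (Fin n)).filter (fun i => z i < r i₀)).card
      = ((Finset.univ : Finset (Fin n)).filter (fun i => r i < r i₀)).card := by
  obtain ⟨i₁, hi₁⟩ := hmem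
  have heq : i₁ = i₀ := window_index_eq r δ hsep (x := r i₀) (hi₁ ▸ hz i₁) ⟨by linarith, by linarith⟩
  subst heq
  rw [← hi₁, filter_lt_enum z (strictMono_of_windows r z δ hsep hz) i₁, hi₁, filter_lt_enum r hr i₁]

/-- **Choice of a window radius.**  For a strictly increasing positive family `r` and finitely many positive
constraints `E`, some `δ > 0` lies below every `rᵢ`, separates the windows (`rᵢ + δ ≤ rⱼ − δ` for `i < j`) and is at most
every constraint. [folklore] -/
theorem exists_window_radius (r : Fin n → ℝ) (hr : StrictMono r) (hr0 : ∀ i, 0 < r i) (E : Finset ℝ)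
    (hE : ∀ e ∈ E, 0 < e) :
    ∃ δ : ℝ, 0 < δ ∧ (∀ i, δ < r i) ∧ (∀ i j : Fin n, i < j → r i + δ ≤ r j - δ) ∧ ∀ e ∈ E, δ ≤ e := by
  classical
  -- all constraints in one finite set of positive reals
  set C : Finset ℝ := (Finset.univ.image r) ∪
      (((Finset.univ : Finset (Fin n × Fin n)).filter (fun p => p.1 < p.2)).image (fun p => (r p.2 - r p.1) / 2)) ∪ E
    with hC
  have hCpos : ∀ c ∈ C, 0 < c := by
    intro c hc
    rw [hC, Finset.mem_union, Finset.mem_union, Finset.mem_image, Finset.mem_image] at hc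
    rcases hc with (⟨i, -, rfl⟩ | ⟨p, hp, rfl⟩) | he
    · exact hr0 i
    · have hlt := (Finset.mem_filter.1 hp).2
      have := hr hlt
      linarith
    · exact hE c he
  by_cases hne : C.Nonempty
  · set m := C.min' hne with hm
    have hmpos : 0 < m := hCpos m (C.min'_mem hne)
    have hmle : ∀ c ∈ C, m ≤ c := fun c hc => C.min'_le c hc
    refine ⟨m / 2, by linarith, fun i => ?_, fun i j hij => ?_, fun e he => ?_⟩
    · have := hmle (r i) (by rw [hC]; simp)
      linarith
    · have hmem : (r j - r i) / 2 ∈ C := by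
        rw [hC, Finset.mem_union, Finset.mem_union]
        refine Or.inl (Or.inr (Finset.mem_image.2 ⟨(i, j), Finset.mem_filter.2 ⟨Finset.mem_univ _, hij⟩, rfl⟩))
      have := hmle _ hmem
      linarith
    · have := hmle e (by rw [hC]; simp [he])
      linarith
  · -- no constraint at all (then `n = 0` and `E = ∅`)
    refine ⟨1, one_pos, fun i => ?_, fun i j _ => ?_, fun e he => ?_⟩
    · exact absurd ⟨r i, by rw [hC]; simp⟩ hne
    · exact absurd ⟨r i, by rw [hC]; simp⟩ hne
    · exact absurd ⟨e, by rw [hC]; simp [he]⟩ hne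

end Windows

/-! ## §2 The local structure theorem -/

section Local

variable {ι : Type} [Fintype ι]

/-- Continuity of `u ↦ uᵀAu`. [folklore] -/
theorem continuous_quadForm (A : Matrix ι ι ℝ) : Continuous fun u : ι → ℝ => u ⬝ᵥ (A *ᵥ u) :=
  Continuous.dotProduct continuous_id (continuous_const.matrix_mulVec continuous_id)

/-- **LOCAL STRUCTURE OF THE RAYLEIGH ROOTS (`locRoots`).**  Rayleigh-sharp pencil; `v ≠ 0`; `r` the increasing
enumeration of the positive roots of `P_v`; `δ > 0` below every `rᵢ` and separating the windows `(rᵢ − δ, rᵢ + δ)`.  Then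
for all `v'` near `v` the positive roots of `P_{v'}` are enumerated by some `z` with `zᵢ ∈ (rᵢ − δ, rᵢ + δ)`: ONE ROOT PER
WINDOW AND NONE ELSEWHERE.  (The sign of `vᵀF(·)v` flips across each window — simple roots, `eval_mul_eval_neg_of_simpleRoot`
— and the flips survive a small perturbation of `v`; the intermediate value theorem puts a root of `P_{v'}` in each window,
and Descartes' budget `K − 1` leaves no other.) [folklore] -/
theorem locRoots {K : ℕ} (hK : 2 ≤ K) (d : Fin K → ℕ) (S : Fin K → Matrix ι ι ℝ)
    (hsharp : ∀ v : ι → ℝ, v ≠ 0 →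
      K ≤ ((∑ l, C (v ⬝ᵥ (S l *ᵥ v)) * (X : ℝ[X]) ^ d l).roots.toFinset.filter (fun t => 0 < t)).card + 1)
    (v : ι → ℝ) (hv : v ≠ 0) (r : Fin (K - 1) → ℝ) (hr : StrictMono r)
    (hrT : ∀ x : ℝ, x ∈ ((∑ l, C (v ⬝ᵥ (S l *ᵥ v)) * (X : ℝ[X]) ^ d l).roots.toFinset.filter (fun t => 0 < t))
      ↔ ∃ i, r i = x)
    {δ : ℝ} (hδ : 0 < δ) (hδ0 : ∀ i, δ < r i) (hsep : ∀ i j : Fin (K - 1), i < j → r i + δ ≤ r j - δ) :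
    ∃ η : ℝ, 0 < η ∧ ∀ v' : ι → ℝ, dist v' v < η →
      ∃ z : Fin (K - 1) → ℝ, (∀ i, r i - δ < z i ∧ z i < r i + δ) ∧
        ∀ x : ℝ, x ∈ ((∑ l, C (v' ⬝ᵥ (S l *ᵥ v')) * (X : ℝ[X]) ^ d l).roots.toFinset.filter (fun t => 0 < t))
          ↔ ∃ i, z i = x := by
  classical
  set Pv := ∑ l, C (v ⬝ᵥ (S l *ᵥ v)) * (X : ℝ[X]) ^ d l with hPv
  have hPv0 : Pv ≠ 0 := rayleighPoly_ne_zero_of_sharp hK d S hsharp v hv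
  have hrmem : ∀ i, Pv.IsRoot (r i) ∧ 0 < r i := by
    intro i
    have h := (hrT (r i)).2 ⟨i, rfl⟩
    rw [Finset.mem_filter, Multiset.mem_toFinset, mem_roots hPv0] at h
    exact h
  -- (a) the sign of `vᵀF(·)v` flips across each window
  have hflip : ∀ i, (v ⬝ᵥ ((∑ k, (r i - δ) ^ d k • S k) *ᵥ v)) * (v ⬝ᵥ ((∑ k, (r i + δ) ^ d k • S k) *ᵥ v)) < 0 := by
    intro i
    rw [← eval_rayleighPoly, ← eval_rayleighPoly]
    refine eval_mul_eval_neg_of_simpleRoot Pv hPv0 (by linarith) (by linarith) (hrmem i).1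
      (rootMultiplicity_le_one_of_sharp Pv (sharp_multiset hK d S hsharp v hv) (hrmem i).2) ?_
    intro y hy1 hy2 hroot
    have hy0 : 0 < y := by linarith [hδ0 i]
    have hyT : y ∈ Pv.roots.toFinset.filter (fun t => 0 < t) := by
      rw [Finset.mem_filter, Multiset.mem_toFinset, mem_roots hPv0]; exact ⟨hroot, hy0⟩
    obtain ⟨j, rfl⟩ := (hrT y).1 hyT
    by_contra hne
    rcases lt_or_gt_of_ne hne with h | h
    · have := hsep j i (hr.lt_iff_lt.1 h); linarith
    · have := hsep i j (hr.lt_iff_lt.1 h); linarith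
  -- (b) these finitely many strict signs survive near `v`
  have hev : ∀ᶠ v' in nhds v, ∀ i : Fin (K - 1),
      0 < (v' ⬝ᵥ ((∑ k, (r i - δ) ^ d k • S k) *ᵥ v')) * (v ⬝ᵥ ((∑ k, (r i - δ) ^ d k • S k) *ᵥ v)) ∧
      0 < (v' ⬝ᵥ ((∑ k, (r i + δ) ^ d k • S k) *ᵥ v')) * (v ⬝ᵥ ((∑ k, (r i + δ) ^ d k • S k) *ᵥ v)) := by
    refine Filter.eventually_all.2 fun i => Filter.Eventually.and ?_ ?_
    · have hne : v ⬝ᵥ ((∑ k, (r i - δ) ^ d k • S k) *ᵥ v) ≠ 0 := fun h => by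
        have := hflip i; rw [h, zero_mul] at this; exact lt_irrefl 0 this
      have hc := ((continuous_quadForm (∑ k, (r i - δ) ^ d k • S k)).mul
        (continuous_const (y := v ⬝ᵥ ((∑ k, (r i - δ) ^ d k • S k) *ᵥ v)))).continuousAt (x := v)
      exact hc.eventually (lt_mem_nhds (mul_self_pos.2 hne))
    · have hne : v ⬝ᵥ ((∑ k, (r i + δ) ^ d k • S k) *ᵥ v) ≠ 0 := fun h => by
        have := hflip i; rw [h, mul_zero] at this; exact lt_irrefl 0 this
      have hc := ((continuous_quadForm (∑ k, (r i + δ) ^ d k • S k)).mul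
        (continuous_const (y := v ⬝ᵥ ((∑ k, (r i + δ) ^ d k • S k) *ᵥ v)))).continuousAt (x := v)
      exact hc.eventually (lt_mem_nhds (mul_self_pos.2 hne))
  obtain ⟨η, hη, hball⟩ := Metric.eventually_nhds_iff.1 hev
  refine ⟨η, hη, fun v' hv' => ?_⟩
  have hsg := hball hv'
  -- (c) one root of `P_{v'}` in each window
  have hneg : ∀ i, (v' ⬝ᵥ ((∑ k, (r i - δ) ^ d k • S k) *ᵥ v')) * (v' ⬝ᵥ ((∑ k, (r i + δ) ^ d k • S k) *ᵥ v')) < 0 := by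
    intro i
    obtain ⟨h1, h2⟩ := hsg i
    have h3 := hflip i
    have h4 : 0 < ((v' ⬝ᵥ ((∑ k, (r i - δ) ^ d k • S k) *ᵥ v')) * (v' ⬝ᵥ ((∑ k, (r i + δ) ^ d k • S k) *ᵥ v')))
        * ((v ⬝ᵥ ((∑ k, (r i - δ) ^ d k • S k) *ᵥ v)) * (v ⬝ᵥ ((∑ k, (r i + δ) ^ d k • S k) *ᵥ v))) := by
      have := mul_pos h1 h2; linarith [this]
    rcases mul_pos_iff.1 h4 with h | h
    · exact absurd h.2 (not_lt.2 h3.le)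
    · exact h.1
  have hzex : ∀ i, ∃ zi : ℝ, r i - δ < zi ∧ zi < r i + δ ∧ v' ⬝ᵥ ((∑ k, zi ^ d k • S k) *ᵥ v') = 0 :=
    fun i => exists_zero_of_mul_neg (continuous_form d S v') (by linarith) (hneg i)
  choose z hz1 hz2 hz3 using hzex
  -- (d) they are all the positive roots of `P_{v'}` (Descartes' budget)
  set Pw := ∑ l, C (v' ⬝ᵥ (S l *ᵥ v')) * (X : ℝ[X]) ^ d l with hPw
  have i₀ : Fin (K - 1) := ⟨0, by omega⟩
  have hPw0 : Pw ≠ 0 := by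
    refine rayleighPoly_ne_zero d S v' (x₀ := r i₀ + δ) fun h => ?_
    have := hneg i₀; rw [h, mul_zero] at this; exact lt_irrefl 0 this
  set T := Pw.roots.toFinset.filter (fun t => 0 < t) with hT
  have hzinj : Function.Injective z := injective_of_windows r z δ hsep fun i => ⟨hz1 i, hz2 i⟩
  have hzsub : Finset.univ.image z ⊆ T := by
    intro x hx
    obtain ⟨i, -, rfl⟩ := Finset.mem_image.1 hx
    rw [hT, mem_posRoots_iff d S v' hPw0]
    exact ⟨by linarith [hz1 i, hδ0 i], hz3 i⟩
  have hcardT : T.card + 1 ≤ K := card_posRoots_le d S v' hPw0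
  have himg : Finset.univ.image z = T := by
    apply Finset.eq_of_subset_of_card_le hzsub
    rw [Finset.card_image_of_injective _ hzinj, Finset.card_univ, Fintype.card_fin]
    omega
  refine ⟨z, fun i => ⟨hz1 i, hz2 i⟩, fun x => ?_⟩
  rw [← himg, Finset.mem_image]
  constructor
  · rintro ⟨i, -, hi⟩; exact ⟨i, hi⟩
  · rintro ⟨i, hi⟩; exact ⟨i, Finset.mem_univ _, hi⟩

/-! ## §3 Counting consequences in root-count currency -/

/-- `N(x, u)` (roots of `P_u` in `(0, x)`) through an enumeration of the positive roots. [folklore] -/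
theorem rootsBelow_enum {K n : ℕ} (d : Fin K → ℕ) (S : Fin K → Matrix ι ι ℝ) (u : ι → ℝ) (z : Fin n → ℝ)
    (hz : Function.Injective z)
    (hT : ∀ x : ℝ, x ∈ ((∑ l, C (u ⬝ᵥ (S l *ᵥ u)) * (X : ℝ[X]) ^ d l).roots.toFinset.filter (fun t => 0 < t))
      ↔ ∃ i, z i = x) (x : ℝ) :
    ((∑ l, C (u ⬝ᵥ (S l *ᵥ u)) * (X : ℝ[X]) ^ d l).roots.toFinset.filter (fun t => 0 < t ∧ t < x)).card
      = ((Finset.univ : Finset (Fin n)).filter (fun i => z i < x)).card := by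
  rw [← Finset.filter_filter, card_filter_enum _ z hz hT]

/-- `N⁺(x, u)` (roots of `P_u` in `(0, x]`) through an enumeration of the positive roots. [folklore] -/
theorem rootsUpTo_enum {K n : ℕ} (d : Fin K → ℕ) (S : Fin K → Matrix ι ι ℝ) (u : ι → ℝ) (z : Fin n → ℝ)
    (hz : Function.Injective z)
    (hT : ∀ x : ℝ, x ∈ ((∑ l, C (u ⬝ᵥ (S l *ᵥ u)) * (X : ℝ[X]) ^ d l).roots.toFinset.filter (fun t => 0 < t))
      ↔ ∃ i, z i = x) (x : ℝ) :
    ((∑ l, C (u ⬝ᵥ (S l *ᵥ u)) * (X : ℝ[X]) ^ d l).roots.toFinset.filter (fun t => 0 < t ∧ t ≤ x)).card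
      = ((Finset.univ : Finset (Fin n)).filter (fun i => z i ≤ x)).card := by
  rw [← Finset.filter_filter, card_filter_enum _ z hz hT]

end Local

end DefiniteMoments

end Summit.ValiantsHypothesis.ValiantsHypothesis.Theorems.LacunarySymmetroidMatrixDescartes
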